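import Summits.HodgeConjecture.HodgeConjecture.Theorems.Ring2WeilCoverageCMFieldCarrierInstancesCyclotomic24
import HarnessLib

/-!
# Ring 2 — Weil-type family-coverage census, CM-field rows (X-AZ): the quartic CM subfields of the atlas
# cyclotomic field(s) `ℚ(ζ₄₀)` OUTSIDE the seven census tables —
# `ℚ(i,√10)`, `ℚ(√-5,√2)`, `ℚ(√-2,√5)`, `ℚ(√-2,√-5)`, `ℚ(√-(5+√5))` —
# their carriers, and on EVERY row `W8.E.δ` of their tables a CM eightfold with HC in the kernel

HONEST FRAMING: research route conditional on HC_CM; not a corollary; Q11.4-sentence-2 already refuted in dim ≥ 3.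

Cell `pub-hodge-ring2`, seat `ring2-b03` (gen 64), census `WEIL-FAMILY-COVERAGE.md` «## b03», open cells (viii′)/(xii′) of b03.19/b03.20
(«the non-census quartic CM subfields of `ℚ(ζ₂₄)`, `ℚ(ζ₄₀)`, `ℚ(ζ₆₀)`»): the cyclic-cover (`ℤ/m`-Prym) eightfolds of the atlas with
`m ∈ {24, 40, 48, 60}` carry, besides the census fields, Weil-type `(2,2;2,2)` structures for FOURTEEN further quartic CM
fields `K' ⊂ ℚ(ζ_m)` (eleven biquadratic, three cyclic of conductors `40`, `48`, `60`); this part treats the five new subfields of `ℚ(ζ₄₀)`: `ℚ(i,√10)`, `ℚ(√-5,√2)`, `ℚ(√-2,√5)`, `ℚ(√-2,√-5)` and the cyclic field `ℚ(√-(5+√5))` of conductor `40` (the twist of `ℚ(ζ₅)` by `√2`).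
Exactly as parts X-L / X-M (`Ring2WeilCoverageCMFieldCarrierInstances{,Biquadratic}`, which rest on part X-K): for each carrier
`R = S² + pS + q` — `E = cmField R = ℚ(η)`, `η⁴ + pη² + q = 0` — the twist `η'` with `η'² + η² + p = 0` (so `E/ℚ` is Galois),
for a biquadratic field a square root `i ∈ E` of `-c` (so `ℚ(√-c) ⊂ E`; member `B⁴`, `B ~ C₁²` of the CM type induced from
`ℚ(√-c)`, HC by Hazama / Pohlmann in the kernel), for a cyclic field the order-`4` substitution `u` with `u(η) = η'`,
`u(η') = -η` (member `B⁴`, `B` a SIMPLE CM surface, HC by Pohlmann in the kernel); all checked by `linear_combination`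
against `η⁴ + pη² + q = 0`:

| field `E` | carrier `(p,q)` | `η'` | `c` / `u` | `i`, `i² = -c` |
|---|---|---|---|---|
| `ℚ(i,√10)` (η = i(1+√10)) | `(22,81)` | `-(η³ + 22η)/9` | `1` | `-(η³ + 13η)/18` |
| `ℚ(√-5,√2)` (η = √-5(1+√2)) | `(30,25)` | `-(η³ + 30η)/5` | `5` | `-(η³ + 25η)/10` |
| `ℚ(√-2,√5)` (η = √-2(1+√5)/2) | `(6,4)` | `-(η³ + 6η)/2` | `2` | `-(η³ + 4η)/2` |
| `ℚ(√-2,√-5)` (η = √-2 + √-5) | `(14,9)` | `-(η³ + 14η)/3` | `2` | `-(η³ + 11η)/6` |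
| `ℚ(√-(5+√5))` (η² = -(5+√5) = 2(ζ₅ - ζ₅⁻¹)²; cyclic, conductor 40) | `(10,20)` | `(η³ + 6η)/2` | `u = (T³ + 6T)/2` | — |

THEOREMS ONLY: no `def`, no named fact, no `sorry`; `HC_CM` does not occur. HONEST COLUMN: named CM members only;
nothing at the general member of any row (crux stmt-1076); the sign of `δ` is not recorded by `IsPolarizationClass`.

## References
* [Deligne1982HodgeCycles] P. Deligne (notes by J. S. Milne), *Hodge cycles on abelian varieties*, LNM 900 (1982), §4, §5 (c).
* [Gordon1999HodgeAVSurvey] B. Gordon, Appendix B to Lewis, *A survey of the Hodge conjecture* (1999), Thm. 6.4 (Hazama).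
* [Pohlmann1968] H. Pohlmann, Ann. of Math. 88 (1968), Thm. 1. [Shimura1998] G. Shimura, *Abelian Varieties with Complex
  Multiplication and Modular Functions* (1998), §8 Ex. 8.4 (2).
-/

noncomputable section

set_option linter.dupNamespace false

namespace Summit.HodgeConjecture.HodgeConjecture.Ring2.WeilCoverageCM

open CategoryTheory CategoryTheory.Limits Polynomial NumberField
open Literature.AlgebraicGeometry Literature.AlgebraicGeometry.Motives Literature.AlgebraicGeometry.HodgeTheory
open Literature.AlgebraicGeometry.ComplexMultiplication Literature.AlgebraicGeometry.Deligne1982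
open Literature.AlgebraicGeometry.Milne1999
open Summit.HodgeConjecture.HodgeConjecture.Ring2.Hypotheses (RosatiCompatible)

/-! ## §1 `ℚ(i,√10)`: `R = S² + 22S + 81` (`η = i(1+√10)`), biquadratic, `ℚ(i) ⊂ E` -/

section SqrtNeg1Sqrt10

variable {R : Polynomial ℤ}

/-- The `Fact` for `E = ℚ(i,√10) = ℚ[T]/(T⁴ + 22T² + 81)` (discriminant `160 = 10·4²`). [folklore] -/
theorem sqrtNeg1Sqrt10_fact_cmPolyQ (hR : R = X ^ 2 + C 22 * X + C 81) : Fact (Irreducible (cmPolyQ R)) :=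
  fact_irreducible_cmPolyQ_of_pos hR (by norm_num) (by norm_num)
    (not_sq_of_eq_nonsquare_mul_sq (n := 10) (not_isSquare_of_sq_lt_of_lt_sq (k := 3) (by norm_num) (by norm_num)) (m := 4)
      (by norm_num) (by norm_num))

/-- In `ℚ(i,√10)`: `η' = -(η³ + 22η)/9 = 9η⁻¹` satisfies `η'² + η² + 22 = 0`. [folklore] -/
theorem sqrtNeg1Sqrt10_twist_sq (hR : R = X ^ 2 + C 22 * X + C 81) [Fact (Irreducible (cmPolyQ R))] :
    (-(cmRoot R ^ 3 + 22 * cmRoot R) / 9) ^ 2 + cmRoot R ^ 2 + ((22 : ℤ) : cmField R) = 0 := by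
  have ht := cmRoot_quartic R hR
  push_cast at ht ⊢
  linear_combination (cmRoot R ^ 2 / 81 + 22 / 81) * ht

/-- In `ℚ(i,√10)`: `i = -(η³ + 13η)/18` satisfies `i² + 1 = 0`. [folklore] -/
theorem sqrtNeg1Sqrt10_sqrtNegOne_sq (hR : R = X ^ 2 + C 22 * X + C 81) [Fact (Irreducible (cmPolyQ R))] :
    (-(cmRoot R ^ 3 + 13 * cmRoot R) / 18) ^ 2 + ((1 : ℤ) : cmField R) = 0 := by
  have ht := cmRoot_quartic R hR
  push_cast at ht ⊢
  linear_combination (cmRoot R ^ 2 / 324 + 1 / 81) * ht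

/-- **`ℚ(i,√10)/ℚ` is Galois.** [folklore] -/
theorem sqrtNeg1Sqrt10_isGalois (hR : R = X ^ 2 + C 22 * X + C 81) [Fact (Irreducible (cmPolyQ R))] :
    IsGalois ℚ (cmField R) :=
  isGalois_of_sq_add R hR _ (sqrtNeg1Sqrt10_twist_sq hR)

/-- **The rows `W8.ℚ(i,√10).δ`: on EVERY row a CM eightfold with HC in the kernel** (`B⁴`, `B ~ C₁²`, `C₁` an elliptic
curve with CM by `ℚ(i)`). [cite: Gordon1999HodgeAVSurvey, Thm. 6.4] [cite: Deligne1982HodgeCycles, §5 (c) pp. 38–39] -/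
theorem sqrtNeg1Sqrt10_carrier_rows_hodgeConjectureFor (hR : R = X ^ 2 + C 22 * X + C 81)
    [Fact (Irreducible (realPolyQ R))] (δ : cmNormResidueGroup R) :
    ∃ (A : AbelianVariety ℂ) (η : A ⟶ A) (h : complexBetti A.X 2),
      A.dim = 8 ∧ IsOfCMType A ∧ IsWeilTypeCM A η R 2 2 ∧ IsPolarizationClass A.dim A.X h ∧ RosatiCompatible A η h ∧
      HasWeilDiscriminantCM A η R 2 2 h δ ∧ HodgeConjectureFor A.dim A.X ∧
      weilClassesField A η (R.comp (X ^ 2)) (2 * 2) ≤ algebraicClasses A.X 2 := by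
  haveI := sqrtNeg1Sqrt10_fact_cmPolyQ hR
  exact carrier_exists_cmEightfold_hodgeConjectureFor_of_sqrt R hR
    (roots_real_neg_of_quadratic hR (by norm_num) (by norm_num) (by norm_num)) _ (sqrtNeg1Sqrt10_twist_sq hR)
    one_pos _ (sqrtNeg1Sqrt10_sqrtNegOne_sq hR) δ

/-- **All ranks over `ℚ(i,√10)`: rows `W_{4n}.E.δ`, every `n ≥ 1` (`g = 4, 8, 12, …`), every `δ`** — a CM member of
induced type (from `ℚ(i)`), Weil type of `E`-rank `2n`, polarization class of discriminant `δ`, HC in the kernel,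
`W_E ⊗ ℂ` algebraic. [cite: Gordon1999HodgeAVSurvey, Thm. 6.4] [cite: Deligne1982HodgeCycles, §5 (c) pp. 38–39] -/
theorem sqrtNeg1Sqrt10_carrier_allRanks_hodgeConjectureFor (hR : R = X ^ 2 + C 22 * X + C 81)
    [Fact (Irreducible (realPolyQ R))] {n : ℕ} (hn : 0 < n) (δ : cmNormResidueGroup R) :
    ∃ (A : AbelianVariety ℂ) (η : A ⟶ A) (h : complexBetti A.X 2),
      IsOfCMType A ∧ IsWeilTypeCM A η R 2 n ∧ IsPolarizationClass A.dim A.X h ∧ RosatiCompatible A η h ∧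
      HasWeilDiscriminantCM A η R 2 n h δ ∧ HodgeConjectureFor A.dim A.X ∧
      weilClassesField A η (R.comp (X ^ 2)) (2 * n) ≤ algebraicClasses A.X n := by
  haveI := sqrtNeg1Sqrt10_fact_cmPolyQ hR
  exact carrier_exists_cmMember_hodgeConjectureFor_of_sqrt R hR
    (roots_real_neg_of_quadratic hR (by norm_num) (by norm_num) (by norm_num)) _ (sqrtNeg1Sqrt10_twist_sq hR)
    one_pos _ (sqrtNeg1Sqrt10_sqrtNegOne_sq hR) hn δ

end SqrtNeg1Sqrt10

/-! ## §2 `ℚ(√-5,√2)`: `R = S² + 30S + 25` (`η = √-5(1+√2)`), biquadratic, `ℚ(√-5) ⊂ E` -/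

section SqrtNeg5Sqrt2

variable {R : Polynomial ℤ}

/-- The `Fact` for `E = ℚ(√-5,√2) = ℚ[T]/(T⁴ + 30T² + 25)` (discriminant `800 = 2·20²`). [folklore] -/
theorem sqrtNeg5Sqrt2_fact_cmPolyQ (hR : R = X ^ 2 + C 30 * X + C 25) : Fact (Irreducible (cmPolyQ R)) :=
  fact_irreducible_cmPolyQ_of_pos hR (by norm_num) (by norm_num)
    (not_sq_of_eq_prime_mul_sq (ℓ := 2) Nat.prime_two (m := 20) (by norm_num) (by norm_num))

/-- In `ℚ(√-5,√2)`: `η' = -(η³ + 30η)/5 = 5η⁻¹` satisfies `η'² + η² + 30 = 0`. [folklore] -/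
theorem sqrtNeg5Sqrt2_twist_sq (hR : R = X ^ 2 + C 30 * X + C 25) [Fact (Irreducible (cmPolyQ R))] :
    (-(cmRoot R ^ 3 + 30 * cmRoot R) / 5) ^ 2 + cmRoot R ^ 2 + ((30 : ℤ) : cmField R) = 0 := by
  have ht := cmRoot_quartic R hR
  push_cast at ht ⊢
  linear_combination (cmRoot R ^ 2 / 25 + 6 / 5) * ht

/-- In `ℚ(√-5,√2)`: `i = -(η³ + 25η)/10` satisfies `i² + 5 = 0`. [folklore] -/
theorem sqrtNeg5Sqrt2_sqrtNegFive_sq (hR : R = X ^ 2 + C 30 * X + C 25) [Fact (Irreducible (cmPolyQ R))] :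
    (-(cmRoot R ^ 3 + 25 * cmRoot R) / 10) ^ 2 + ((5 : ℤ) : cmField R) = 0 := by
  have ht := cmRoot_quartic R hR
  push_cast at ht ⊢
  linear_combination (cmRoot R ^ 2 / 100 + 1 / 5) * ht

/-- **`ℚ(√-5,√2)/ℚ` is Galois.** [folklore] -/
theorem sqrtNeg5Sqrt2_isGalois (hR : R = X ^ 2 + C 30 * X + C 25) [Fact (Irreducible (cmPolyQ R))] :
    IsGalois ℚ (cmField R) :=
  isGalois_of_sq_add R hR _ (sqrtNeg5Sqrt2_twist_sq hR)

/-- **The rows `W8.ℚ(√-5,√2).δ`: on EVERY row a CM eightfold with HC in the kernel** (`B⁴`, `B ~ C₁²`, `C₁` an elliptic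
curve with CM by `ℚ(√-5)`). [cite: Gordon1999HodgeAVSurvey, Thm. 6.4] [cite: Deligne1982HodgeCycles, §5 (c) pp. 38–39] -/
theorem sqrtNeg5Sqrt2_carrier_rows_hodgeConjectureFor (hR : R = X ^ 2 + C 30 * X + C 25)
    [Fact (Irreducible (realPolyQ R))] (δ : cmNormResidueGroup R) :
    ∃ (A : AbelianVariety ℂ) (η : A ⟶ A) (h : complexBetti A.X 2),
      A.dim = 8 ∧ IsOfCMType A ∧ IsWeilTypeCM A η R 2 2 ∧ IsPolarizationClass A.dim A.X h ∧ RosatiCompatible A η h ∧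
      HasWeilDiscriminantCM A η R 2 2 h δ ∧ HodgeConjectureFor A.dim A.X ∧
      weilClassesField A η (R.comp (X ^ 2)) (2 * 2) ≤ algebraicClasses A.X 2 := by
  haveI := sqrtNeg5Sqrt2_fact_cmPolyQ hR
  exact carrier_exists_cmEightfold_hodgeConjectureFor_of_sqrt R hR
    (roots_real_neg_of_quadratic hR (by norm_num) (by norm_num) (by norm_num)) _ (sqrtNeg5Sqrt2_twist_sq hR)
    (by norm_num) _ (sqrtNeg5Sqrt2_sqrtNegFive_sq hR) δ

/-- **All ranks over `ℚ(√-5,√2)`: rows `W_{4n}.E.δ`, every `n ≥ 1` (`g = 4, 8, 12, …`), every `δ`** — a CM member of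
induced type (from `ℚ(√-5)`), Weil type of `E`-rank `2n`, polarization class of discriminant `δ`, HC in the kernel,
`W_E ⊗ ℂ` algebraic. [cite: Gordon1999HodgeAVSurvey, Thm. 6.4] [cite: Deligne1982HodgeCycles, §5 (c) pp. 38–39] -/
theorem sqrtNeg5Sqrt2_carrier_allRanks_hodgeConjectureFor (hR : R = X ^ 2 + C 30 * X + C 25)
    [Fact (Irreducible (realPolyQ R))] {n : ℕ} (hn : 0 < n) (δ : cmNormResidueGroup R) :
    ∃ (A : AbelianVariety ℂ) (η : A ⟶ A) (h : complexBetti A.X 2),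
      IsOfCMType A ∧ IsWeilTypeCM A η R 2 n ∧ IsPolarizationClass A.dim A.X h ∧ RosatiCompatible A η h ∧
      HasWeilDiscriminantCM A η R 2 n h δ ∧ HodgeConjectureFor A.dim A.X ∧
      weilClassesField A η (R.comp (X ^ 2)) (2 * n) ≤ algebraicClasses A.X n := by
  haveI := sqrtNeg5Sqrt2_fact_cmPolyQ hR
  exact carrier_exists_cmMember_hodgeConjectureFor_of_sqrt R hR
    (roots_real_neg_of_quadratic hR (by norm_num) (by norm_num) (by norm_num)) _ (sqrtNeg5Sqrt2_twist_sq hR)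
    (by norm_num) _ (sqrtNeg5Sqrt2_sqrtNegFive_sq hR) hn δ

end SqrtNeg5Sqrt2

/-! ## §3 `ℚ(√-2,√5)`: `R = S² + 6S + 4` (`η = √-2(1+√5)/2`), biquadratic, `ℚ(√-2) ⊂ E` -/

section SqrtNeg2Sqrt5

variable {R : Polynomial ℤ}

/-- The `Fact` for `E = ℚ(√-2,√5) = ℚ[T]/(T⁴ + 6T² + 4)` (discriminant `20 = 5·2²`). [folklore] -/
theorem sqrtNeg2Sqrt5_fact_cmPolyQ (hR : R = X ^ 2 + C 6 * X + C 4) : Fact (Irreducible (cmPolyQ R)) :=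
  fact_irreducible_cmPolyQ_of_pos hR (by norm_num) (by norm_num)
    (not_sq_of_eq_prime_mul_sq (ℓ := 5) Nat.prime_five (m := 2) (by norm_num) (by norm_num))

/-- In `ℚ(√-2,√5)`: `η' = -(η³ + 6η)/2 = 2η⁻¹` satisfies `η'² + η² + 6 = 0`. [folklore] -/
theorem sqrtNeg2Sqrt5_twist_sq (hR : R = X ^ 2 + C 6 * X + C 4) [Fact (Irreducible (cmPolyQ R))] :
    (-(cmRoot R ^ 3 + 6 * cmRoot R) / 2) ^ 2 + cmRoot R ^ 2 + ((6 : ℤ) : cmField R) = 0 := by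
  have ht := cmRoot_quartic R hR
  push_cast at ht ⊢
  linear_combination (cmRoot R ^ 2 / 4 + 3 / 2) * ht

/-- In `ℚ(√-2,√5)`: `i = -(η³ + 4η)/2` satisfies `i² + 2 = 0`. [folklore] -/
theorem sqrtNeg2Sqrt5_sqrtNegTwo_sq (hR : R = X ^ 2 + C 6 * X + C 4) [Fact (Irreducible (cmPolyQ R))] :
    (-(cmRoot R ^ 3 + 4 * cmRoot R) / 2) ^ 2 + ((2 : ℤ) : cmField R) = 0 := by
  have ht := cmRoot_quartic R hR
  push_cast at ht ⊢
  linear_combination (cmRoot R ^ 2 / 4 + 1 / 2) * ht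

/-- **`ℚ(√-2,√5)/ℚ` is Galois.** [folklore] -/
theorem sqrtNeg2Sqrt5_isGalois (hR : R = X ^ 2 + C 6 * X + C 4) [Fact (Irreducible (cmPolyQ R))] :
    IsGalois ℚ (cmField R) :=
  isGalois_of_sq_add R hR _ (sqrtNeg2Sqrt5_twist_sq hR)

/-- **The rows `W8.ℚ(√-2,√5).δ`: on EVERY row a CM eightfold with HC in the kernel** (`B⁴`, `B ~ C₁²`, `C₁` an elliptic
curve with CM by `ℚ(√-2)`). [cite: Gordon1999HodgeAVSurvey, Thm. 6.4] [cite: Deligne1982HodgeCycles, §5 (c) pp. 38–39] -/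
theorem sqrtNeg2Sqrt5_carrier_rows_hodgeConjectureFor (hR : R = X ^ 2 + C 6 * X + C 4)
    [Fact (Irreducible (realPolyQ R))] (δ : cmNormResidueGroup R) :
    ∃ (A : AbelianVariety ℂ) (η : A ⟶ A) (h : complexBetti A.X 2),
      A.dim = 8 ∧ IsOfCMType A ∧ IsWeilTypeCM A η R 2 2 ∧ IsPolarizationClass A.dim A.X h ∧ RosatiCompatible A η h ∧
      HasWeilDiscriminantCM A η R 2 2 h δ ∧ HodgeConjectureFor A.dim A.X ∧
      weilClassesField A η (R.comp (X ^ 2)) (2 * 2) ≤ algebraicClasses A.X 2 := by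
  haveI := sqrtNeg2Sqrt5_fact_cmPolyQ hR
  exact carrier_exists_cmEightfold_hodgeConjectureFor_of_sqrt R hR
    (roots_real_neg_of_quadratic hR (by norm_num) (by norm_num) (by norm_num)) _ (sqrtNeg2Sqrt5_twist_sq hR)
    (by norm_num) _ (sqrtNeg2Sqrt5_sqrtNegTwo_sq hR) δ

/-- **All ranks over `ℚ(√-2,√5)`: rows `W_{4n}.E.δ`, every `n ≥ 1` (`g = 4, 8, 12, …`), every `δ`** — a CM member of
induced type (from `ℚ(√-2)`), Weil type of `E`-rank `2n`, polarization class of discriminant `δ`, HC in the kernel,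
`W_E ⊗ ℂ` algebraic. [cite: Gordon1999HodgeAVSurvey, Thm. 6.4] [cite: Deligne1982HodgeCycles, §5 (c) pp. 38–39] -/
theorem sqrtNeg2Sqrt5_carrier_allRanks_hodgeConjectureFor (hR : R = X ^ 2 + C 6 * X + C 4)
    [Fact (Irreducible (realPolyQ R))] {n : ℕ} (hn : 0 < n) (δ : cmNormResidueGroup R) :
    ∃ (A : AbelianVariety ℂ) (η : A ⟶ A) (h : complexBetti A.X 2),
      IsOfCMType A ∧ IsWeilTypeCM A η R 2 n ∧ IsPolarizationClass A.dim A.X h ∧ RosatiCompatible A η h ∧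
      HasWeilDiscriminantCM A η R 2 n h δ ∧ HodgeConjectureFor A.dim A.X ∧
      weilClassesField A η (R.comp (X ^ 2)) (2 * n) ≤ algebraicClasses A.X n := by
  haveI := sqrtNeg2Sqrt5_fact_cmPolyQ hR
  exact carrier_exists_cmMember_hodgeConjectureFor_of_sqrt R hR
    (roots_real_neg_of_quadratic hR (by norm_num) (by norm_num) (by norm_num)) _ (sqrtNeg2Sqrt5_twist_sq hR)
    (by norm_num) _ (sqrtNeg2Sqrt5_sqrtNegTwo_sq hR) hn δ

end SqrtNeg2Sqrt5

/-! ## §4 `ℚ(√-2,√-5)`: `R = S² + 14S + 9` (`η = √-2 + √-5`), biquadratic, `ℚ(√-2) ⊂ E` -/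

section SqrtNeg2SqrtNeg5

variable {R : Polynomial ℤ}

/-- The `Fact` for `E = ℚ(√-2,√-5) = ℚ[T]/(T⁴ + 14T² + 9)` (discriminant `160 = 10·4²`). [folklore] -/
theorem sqrtNeg2SqrtNeg5_fact_cmPolyQ (hR : R = X ^ 2 + C 14 * X + C 9) : Fact (Irreducible (cmPolyQ R)) :=
  fact_irreducible_cmPolyQ_of_pos hR (by norm_num) (by norm_num)
    (not_sq_of_eq_nonsquare_mul_sq (n := 10) (not_isSquare_of_sq_lt_of_lt_sq (k := 3) (by norm_num) (by norm_num)) (m := 4)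
      (by norm_num) (by norm_num))

/-- In `ℚ(√-2,√-5)`: `η' = -(η³ + 14η)/3 = 3η⁻¹` satisfies `η'² + η² + 14 = 0`. [folklore] -/
theorem sqrtNeg2SqrtNeg5_twist_sq (hR : R = X ^ 2 + C 14 * X + C 9) [Fact (Irreducible (cmPolyQ R))] :
    (-(cmRoot R ^ 3 + 14 * cmRoot R) / 3) ^ 2 + cmRoot R ^ 2 + ((14 : ℤ) : cmField R) = 0 := by
  have ht := cmRoot_quartic R hR
  push_cast at ht ⊢
  linear_combination (cmRoot R ^ 2 / 9 + 14 / 9) * ht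

/-- In `ℚ(√-2,√-5)`: `i = -(η³ + 11η)/6` satisfies `i² + 2 = 0`. [folklore] -/
theorem sqrtNeg2SqrtNeg5_sqrtNegTwo_sq (hR : R = X ^ 2 + C 14 * X + C 9) [Fact (Irreducible (cmPolyQ R))] :
    (-(cmRoot R ^ 3 + 11 * cmRoot R) / 6) ^ 2 + ((2 : ℤ) : cmField R) = 0 := by
  have ht := cmRoot_quartic R hR
  push_cast at ht ⊢
  linear_combination (cmRoot R ^ 2 / 36 + 2 / 9) * ht

/-- **`ℚ(√-2,√-5)/ℚ` is Galois.** [folklore] -/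
theorem sqrtNeg2SqrtNeg5_isGalois (hR : R = X ^ 2 + C 14 * X + C 9) [Fact (Irreducible (cmPolyQ R))] :
    IsGalois ℚ (cmField R) :=
  isGalois_of_sq_add R hR _ (sqrtNeg2SqrtNeg5_twist_sq hR)

/-- **The rows `W8.ℚ(√-2,√-5).δ`: on EVERY row a CM eightfold with HC in the kernel** (`B⁴`, `B ~ C₁²`, `C₁` an elliptic
curve with CM by `ℚ(√-2)`). [cite: Gordon1999HodgeAVSurvey, Thm. 6.4] [cite: Deligne1982HodgeCycles, §5 (c) pp. 38–39] -/
theorem sqrtNeg2SqrtNeg5_carrier_rows_hodgeConjectureFor (hR : R = X ^ 2 + C 14 * X + C 9)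
    [Fact (Irreducible (realPolyQ R))] (δ : cmNormResidueGroup R) :
    ∃ (A : AbelianVariety ℂ) (η : A ⟶ A) (h : complexBetti A.X 2),
      A.dim = 8 ∧ IsOfCMType A ∧ IsWeilTypeCM A η R 2 2 ∧ IsPolarizationClass A.dim A.X h ∧ RosatiCompatible A η h ∧
      HasWeilDiscriminantCM A η R 2 2 h δ ∧ HodgeConjectureFor A.dim A.X ∧
      weilClassesField A η (R.comp (X ^ 2)) (2 * 2) ≤ algebraicClasses A.X 2 := by
  haveI := sqrtNeg2SqrtNeg5_fact_cmPolyQ hR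
  exact carrier_exists_cmEightfold_hodgeConjectureFor_of_sqrt R hR
    (roots_real_neg_of_quadratic hR (by norm_num) (by norm_num) (by norm_num)) _ (sqrtNeg2SqrtNeg5_twist_sq hR)
    (by norm_num) _ (sqrtNeg2SqrtNeg5_sqrtNegTwo_sq hR) δ

/-- **All ranks over `ℚ(√-2,√-5)`: rows `W_{4n}.E.δ`, every `n ≥ 1` (`g = 4, 8, 12, …`), every `δ`** — a CM member of
induced type (from `ℚ(√-2)`), Weil type of `E`-rank `2n`, polarization class of discriminant `δ`, HC in the kernel,
`W_E ⊗ ℂ` algebraic. [cite: Gordon1999HodgeAVSurvey, Thm. 6.4] [cite: Deligne1982HodgeCycles, §5 (c) pp. 38–39] -/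
theorem sqrtNeg2SqrtNeg5_carrier_allRanks_hodgeConjectureFor (hR : R = X ^ 2 + C 14 * X + C 9)
    [Fact (Irreducible (realPolyQ R))] {n : ℕ} (hn : 0 < n) (δ : cmNormResidueGroup R) :
    ∃ (A : AbelianVariety ℂ) (η : A ⟶ A) (h : complexBetti A.X 2),
      IsOfCMType A ∧ IsWeilTypeCM A η R 2 n ∧ IsPolarizationClass A.dim A.X h ∧ RosatiCompatible A η h ∧
      HasWeilDiscriminantCM A η R 2 n h δ ∧ HodgeConjectureFor A.dim A.X ∧
      weilClassesField A η (R.comp (X ^ 2)) (2 * n) ≤ algebraicClasses A.X n := by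
  haveI := sqrtNeg2SqrtNeg5_fact_cmPolyQ hR
  exact carrier_exists_cmMember_hodgeConjectureFor_of_sqrt R hR
    (roots_real_neg_of_quadratic hR (by norm_num) (by norm_num) (by norm_num)) _ (sqrtNeg2SqrtNeg5_twist_sq hR)
    (by norm_num) _ (sqrtNeg2SqrtNeg5_sqrtNegTwo_sq hR) hn δ

end SqrtNeg2SqrtNeg5

/-! ## §5 `ℚ(√-(5+√5))`: `R = S² + 10S + 20` (`η² = -(5+√5) = 2(ζ₅ - ζ₅⁻¹)²`), CYCLIC (conductor 40) -/

section SqrtNegFivePlusSqrtFive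

variable {R : Polynomial ℤ}

/-- The `Fact` for `E = ℚ(√-(5+√5)) = ℚ[T]/(T⁴ + 10T² + 20)` (discriminant `20 = 5·2²`). [folklore] -/
theorem sqrtNegFivePlusSqrtFive_fact_cmPolyQ (hR : R = X ^ 2 + C 10 * X + C 20) : Fact (Irreducible (cmPolyQ R)) :=
  fact_irreducible_cmPolyQ_of_pos hR (by norm_num) (by norm_num)
    (not_sq_of_eq_prime_mul_sq (ℓ := 5) Nat.prime_five (m := 2) (by norm_num) (by norm_num))

/-- In `ℚ(√-(5+√5))`: `η' = (η³ + 6η)/2` satisfies `η'² + η² + 10 = 0` (`η η'` is `2√5 = -2(η² + 5)`). [folklore] -/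
theorem sqrtNegFivePlusSqrtFive_twist_sq (hR : R = X ^ 2 + C 10 * X + C 20) [Fact (Irreducible (cmPolyQ R))] :
    ((cmRoot R ^ 3 + 6 * cmRoot R) / 2) ^ 2 + cmRoot R ^ 2 + ((10 : ℤ) : cmField R) = 0 := by
  have ht := cmRoot_quartic R hR
  push_cast at ht ⊢
  linear_combination (cmRoot R ^ 2 / 4 + 1 / 2) * ht

/-- **`ℚ(√-(5+√5))/ℚ` is Galois.** [folklore] -/
theorem sqrtNegFivePlusSqrtFive_isGalois (hR : R = X ^ 2 + C 10 * X + C 20) [Fact (Irreducible (cmPolyQ R))] :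
    IsGalois ℚ (cmField R) :=
  isGalois_of_sq_add R hR _ (sqrtNegFivePlusSqrtFive_twist_sq hR)

/-- **`Gal(ℚ(√-(5+√5))/ℚ)` is cyclic** (`σ : η ↦ (η³ + 6η)/2`, `σ²(η) = -η`). [folklore] -/
theorem sqrtNegFivePlusSqrtFive_isCyclic (hR : R = X ^ 2 + C 10 * X + C 20) [Fact (Irreducible (cmPolyQ R))] :
    IsCyclic (cmField R ≃ₐ[ℚ] cmField R) := by
  have ht := cmRoot_quartic R hR
  push_cast at ht
  refine isCyclic_of_sq_add R hR _ (sqrtNegFivePlusSqrtFive_twist_sq hR) (C (1 / 2 : ℚ) * (X ^ 3 + 6 * X)) ?_ ?_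
  · simp only [map_add, map_mul, map_pow, aeval_X, aeval_C, map_div₀, map_one, map_ofNat]
    ring
  · simp only [map_add, map_mul, map_pow, aeval_X, aeval_C, map_div₀, map_one, map_ofNat]
    linear_combination (cmRoot R ^ 5 / 16 + cmRoot R ^ 3 / 2 + cmRoot R / 2) * ht

/-- **The rows `W8.ℚ(√-(5+√5)).δ`: on EVERY row a CM eightfold with HC in the kernel** (`A ≅ B⁴`, `B` a SIMPLE CM
surface). [cite: Pohlmann1968, Thm. 1] [cite: Deligne1982HodgeCycles, §5 (c) pp. 38–39] -/
theorem sqrtNegFivePlusSqrtFive_carrier_rows_hodgeConjectureFor (hR : R = X ^ 2 + C 10 * X + C 20)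
    [Fact (Irreducible (realPolyQ R))] (δ : cmNormResidueGroup R) :
    ∃ (A : AbelianVariety ℂ) (η : A ⟶ A) (h : complexBetti A.X 2) (B : AbelianVariety ℂ),
      Nonempty (A ≅ ⨁ fun _ : Fin 4 => B) ∧ B.IsSimple ∧ B.dim = 2 ∧ IsOfCMType B ∧ A.dim = 8 ∧ IsOfCMType A ∧
      IsWeilTypeCM A η R 2 2 ∧ IsPolarizationClass A.dim A.X h ∧ RosatiCompatible A η h ∧
      HasWeilDiscriminantCM A η R 2 2 h δ ∧ HodgeConjectureFor A.dim A.X ∧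
      weilClassesField A η (R.comp (X ^ 2)) (2 * 2) ≤ algebraicClasses A.X 2 := by
  haveI := sqrtNegFivePlusSqrtFive_fact_cmPolyQ hR
  have hroots := roots_real_neg_of_quadratic hR (by norm_num) (by norm_num) (by norm_num)
  haveI : IsCMField (cmField R) := isCMField_cmField hroots
  haveI := sqrtNegFivePlusSqrtFive_isGalois hR
  obtain ⟨hRm, hRdeg⟩ := monic_and_natDegree_of_quadratic R hR
  exact carrier_exists_cmEightfold_hodgeConjectureFor_of_isCyclic R hRm hRdeg hroots
    (sqrtNegFivePlusSqrtFive_isCyclic hR) δ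

/-- **All ranks over `ℚ(√-(5+√5))`: rows `W_{4n}.E.δ`, every `n ≥ 1`, every `δ`:** `B^{2n}`, `B` a SIMPLE CM surface,
Weil type of `E`-rank `2n`, polarization class of discriminant `δ`, HC in the kernel, `W_E ⊗ ℂ` algebraic.
[cite: Pohlmann1968, Thm. 1] [cite: Deligne1982HodgeCycles, §5 (c) pp. 38–39] -/
theorem sqrtNegFivePlusSqrtFive_carrier_allRanks_hodgeConjectureFor (hR : R = X ^ 2 + C 10 * X + C 20)
    [Fact (Irreducible (realPolyQ R))] {n : ℕ} (hn : 0 < n) (δ : cmNormResidueGroup R) :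
    ∃ (B : AbelianVariety ℂ) (η : (⨁ fun _ : Fin (2 * n) => B) ⟶ ⨁ fun _ : Fin (2 * n) => B)
      (h : complexBetti (⨁ fun _ : Fin (2 * n) => B).X 2),
      B.IsSimple ∧ B.dim = 2 ∧ IsOfCMType B ∧
      IsOfCMType (⨁ fun _ : Fin (2 * n) => B) ∧ IsWeilTypeCM (⨁ fun _ : Fin (2 * n) => B) η R 2 n ∧
      IsPolarizationClass (⨁ fun _ : Fin (2 * n) => B).dim (⨁ fun _ : Fin (2 * n) => B).X h ∧
      RosatiCompatible (⨁ fun _ : Fin (2 * n) => B) η h ∧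
      HasWeilDiscriminantCM (⨁ fun _ : Fin (2 * n) => B) η R 2 n h δ ∧
      HodgeConjectureFor (⨁ fun _ : Fin (2 * n) => B).dim (⨁ fun _ : Fin (2 * n) => B).X ∧
      weilClassesField (⨁ fun _ : Fin (2 * n) => B) η (R.comp (X ^ 2)) (2 * n) ≤
        algebraicClasses (⨁ fun _ : Fin (2 * n) => B).X n := by
  haveI := sqrtNegFivePlusSqrtFive_fact_cmPolyQ hR
  have hroots := roots_real_neg_of_quadratic hR (by norm_num) (by norm_num) (by norm_num)
  haveI : IsCMField (cmField R) := isCMField_cmField hroots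
  haveI := sqrtNegFivePlusSqrtFive_isGalois hR
  obtain ⟨hRm, hRdeg⟩ := monic_and_natDegree_of_quadratic R hR
  exact carrier_exists_simplePower_hodgeConjectureFor_of_isCyclic R hRm hRdeg le_rfl hroots
    (sqrtNegFivePlusSqrtFive_isCyclic hR) hn δ

end SqrtNegFivePlusSqrtFive

end Summit.HodgeConjecture.HodgeConjecture.Ring2.WeilCoverageCM

end
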